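/-
Copyright: the b2b-balaban T⁴-continuum CRUX team, row NE7b leaf lineage `t4-ne7b-formalise-leaf-03` (gen 150). Project licence.
-/
import Mathlib.Analysis.Normed.Operator.Bilinear
import Mathlib.Analysis.Normed.Operator.Mul

/-!
# DOMINATION BY A PULLBACK PASSES THROUGH THE HARD STEP FOR FREE: if the fine form dominates the pullback of a coarse MODEL form,
# `γ·R(Dx)(Dx) ≤ Q x x` for all `x`, then EVERY transported form `Q[T·, T·]` along a section `T` of `D` dominates `γ·R` — so the
# coarse model form's kernel coercivity (a Poincaré letter of the MODEL, per scale) is the next floor of the transported Hessian with NO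
# transport loss, and along a tower the level-`k` domination `Q_k ≥ γ·R_k` is ONE pullback inequality for the composite blocking at the
# FINE level (row NE7b, node U5c; Mathlib only; [folklore] — one line; the abstract half of print's (1.67) «`Δ_k ≥ γ₀(−Δ)`», the pricing
# desk's located missing supplier F698 (iii))

Cell `pub-balaban`, sub-cell `t4`, spine estimate NE7b (`T4WeightBudget.RelWeightBound`; the cell's OWN estimate — NOT PRINTED in
[Bałaban 1983–89], NOT PROVED).  Crux-route work under `Spine/NE7b/` by leaf-03 (CRUX team (2), FREEZE (0) crux-prover clause) in the
hard-step cell.  NOTHING of Bałaban's is named, asserted, valued or discharged; no `T4Continuum/Support` leaf typed; no `def`; zero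
`sorry`.  Imports: Mathlib ONLY.  Met BY SHAPE (not imported, nothing restated): this lineage's TFC (`kerCoercive_bilinearComp_div`: the
crude transport `m₂∕d²`), HSSG ∕ HSGT (composite blockings `Dc k` and sections `Tc k`, `Q_k = Q.bilinearComp (Tc k) (Tc k)`), leaf-01's
TSPB (`…TwoScalePoincareBlocking`: the nearest-neighbour Dirichlet form's Poincaré letters per block scale — a MODEL form `R`'s
coercivity, by value for the free lattice field), the tree's `Literature.….B5Ineq167LowerZd` (print's (1.67) lower constant, scalar shadow).

WHY.  The pricing desk's by-value tables (PRICING-NE7b v119 F698 ∕ F699) locate what is and is not uniform along the free Gaussian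
tower: TFC's coercivity transport loses `×1.155` per step if iterated, `0.8225` once on the composite (HSSG); the per-scale RESET
«domination × Neumann–Poincaré» (F699 (A2)) is uniform — but «TSPB values the NEAREST-NEIGHBOUR Dirichlet form only; its per-scale reset
transfers to the ACTUAL scale-`k` Hessian iff `Δ_k ≥ γ₀·(−Δ)` (print (1.67), `γ₀ = 1` by value, `dom_k ≥ 1` sharp) — NO `Spine/NE7b` file
states the domination of the scale-`k` Hessian by the nearest-neighbour form for `k ≥ 1`» (F698 (iii)).  The abstract half of that
domination is one line and model-free: the transported form is `Q` evaluated on a section, `Q⁺ g g = Q (Tg)(Tg)`, and `D (T g) = g`, so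
ANY fine-level inequality of the shape `γ·R(Dx)(Dx) ≤ Q x x` — «the fine form dominates the PULLBACK of the coarse model form `R`» —
descends verbatim: `γ·R g g ≤ Q⁺ g g`.  Consequently (§2) the next floor of `Q⁺` on `ker D₂` is `γ` times the MODEL form's floor
(`R` `m_R`-coercive on `ker D₂`: a Poincaré letter of the coarse model, e.g. TSPB at ONE block scale), with no `‖D‖`, no `d²`, no
transport loss; and (§3) along a tower nothing is iterated: the level-`k` domination `γ·R_k ≤ Q_k` IS the fine-level pullback inequality
`γ·R_k (Dc k x)(Dc k x) ≤ Q x x` for the COMPOSITE blocking — for block averagings a Cauchy–Schwarz inequality along lattice paths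
(the model half, leaf-01 ∕ leaf-02's currency; NOT HERE).  The size direction is THEC's (test sections); this file is the floor direction.

WHAT IS PROVED ([folklore]; `E`, `F`, `G` real normed spaces, `Q : E →L E →L ℝ`, `R : F →L F →L ℝ` (no symmetry), `D : E →L F`,
`T : F →L E` with `D (T g) = g`):
* §1 **`le_transported_of_le_pullback`** (`∀ x, R (D x) (D x) ≤ Q x x` ⟹ `∀ g, R g g ≤ (Q.bilinearComp T T) g g`),
  **`smul_le_transported_of_le_pullback`** (with a constant: `γ·R(Dx)(Dx) ≤ Q x x` ⟹ `γ·R g g ≤ Q⁺ g g`), `transported_le_of_pullback_le`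
  (the upper direction for the SAME section: `Q x x ≤ Γ·R(Dx)(Dx)` on `range T` suffices — `Q⁺ g g ≤ Γ·R g g`).
* §2 THE PER-SCALE RESET: **`kerCoercive_transported_of_domination`** (`γ·R(D·)(D·) ≤ Q`, `R` `m`-coercive on `ker D₂`, `0 ≤ γ` ⟹
  `∀ g, D₂ g = 0 → (γ·m)‖g‖² ≤ Q⁺ g g` — the next floor from the MODEL form's floor, no transport loss), `coercive_transported_of_domination`
  (the same on all of `F`), `kerCoercive_transported_of_domination_max` (both suppliers at hand — TFC's `m₂∕d²` as a displayed real `m′` with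
  its letter, and the reset `γ·m` — give the floor `max m′ (γ·m)`).
* §3 THE TOWER IN ONE SHOT (HSGT's shapes, no induction needed): **`tower_domination`** (composites `Dc k`, `Tc k` with `Dc k (Tc k g) = g`;
  `∀ x, γ·R_k (Dc k x)(Dc k x) ≤ Q x x` ⟹ `γ·R_k ≤ Q_k := Q.bilinearComp (Tc k) (Tc k)` at level `k`), **`tower_kerCoercive_of_domination`**
  (+ `R_k` `m_k`-coercive on `ker (D k)` ⟹ `Q_k` `(γ·m_k)`-coercive on `ker (D k)`).
* §4 toy (`ℝ`, `Q = R = mul`, `D = T = 1`, `γ = 1`).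

NOT HERE (honest): the MODEL half — the fine-level pullback inequalities `γ·R_k (Dc k x)(Dc k x) ≤ Q x x` BY VALUE for block averagings
and the lattice Dirichlet form (Cauchy–Schwarz along paths; print's (1.67) `γ₀`; leaf-01 ∕ leaf-02's block-average letters), the model
forms' Poincaré letters (TSPB), anything of Bałaban's ((A3) ∕ (A1c), NC-NE7b-α UNRULED).  BY-NAME EFFECT ON THE WALL: NONE.  NE7b NOT
PRINTED ∕ NOT PROVED; spine PROVED 0∕9; rung (B)+1 on a FINITE torus — NOT infinite volume, NOT the mass gap, NOT Clay.  HONEST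
DEPENDENCY: continuum YM on T⁴ ⇐ BetaPertH ∧ nine spine estimates (0∕9 proved); BetaPertH ⇐ (D1) ∧ (D4) ∧ CAP+tail; G-an2-4 gates
asym, D1 and NE2∕3∕4.
-/

set_option autoImplicit false

namespace Summit.QuantumFields.BalabanUV.T4Continuum.NE7b.DominationTransfer

variable {E F G : Type*} [NormedAddCommGroup E] [NormedSpace ℝ E] [NormedAddCommGroup F] [NormedSpace ℝ F]
  [NormedAddCommGroup G] [NormedSpace ℝ G]

/-! ## §1. Domination by a pullback descends to every transported form -/

omit [NormedAddCommGroup G] [NormedSpace ℝ G] in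
/-- **DOMINATION BY A PULLBACK DESCENDS.**  If the fine form dominates the pullback of a coarse form, `R (D x) (D x) ≤ Q x x` for all
`x`, then for ANY section `T` of `D` the transported form dominates `R`: `R g g ≤ (Q.bilinearComp T T) g g` (evaluate at `x = T g`,
`D (T g) = g`). [folklore] -/
theorem le_transported_of_le_pullback (Q : E →L[ℝ] E →L[ℝ] ℝ) (R : F →L[ℝ] F →L[ℝ] ℝ) {D : E →L[ℝ] F} {T : F →L[ℝ] E}
    (hT : ∀ g, D (T g) = g) (hRQ : ∀ x, R (D x) (D x) ≤ Q x x) (g : F) : R g g ≤ (Q.bilinearComp T T) g g := by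
  rw [ContinuousLinearMap.bilinearComp_apply]
  have h := hRQ (T g)
  rwa [hT] at h

omit [NormedAddCommGroup G] [NormedSpace ℝ G] in
/-- With a constant: `γ·R (D x) (D x) ≤ Q x x` for all `x` ⟹ `γ·R g g ≤ (Q.bilinearComp T T) g g`. [folklore] -/
theorem smul_le_transported_of_le_pullback (Q : E →L[ℝ] E →L[ℝ] ℝ) (R : F →L[ℝ] F →L[ℝ] ℝ) {D : E →L[ℝ] F} {T : F →L[ℝ] E}
    (hT : ∀ g, D (T g) = g) {γ : ℝ} (hRQ : ∀ x, γ * R (D x) (D x) ≤ Q x x) (g : F) :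
    γ * R g g ≤ (Q.bilinearComp T T) g g := by
  rw [ContinuousLinearMap.bilinearComp_apply]
  have h := hRQ (T g)
  rwa [hT] at h

omit [NormedAddCommGroup G] [NormedSpace ℝ G] in
/-- The upper direction for the SAME section: if `Q x x ≤ Γ·R (D x) (D x)` on the range of `T` (it suffices there), then
`(Q.bilinearComp T T) g g ≤ Γ·R g g`. [folklore] -/
theorem transported_le_of_pullback_le (Q : E →L[ℝ] E →L[ℝ] ℝ) (R : F →L[ℝ] F →L[ℝ] ℝ) {D : E →L[ℝ] F} {T : F →L[ℝ] E}
    (hT : ∀ g, D (T g) = g) {Γ : ℝ} (hQR : ∀ g, Q (T g) (T g) ≤ Γ * R (D (T g)) (D (T g))) (g : F) :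
    (Q.bilinearComp T T) g g ≤ Γ * R g g := by
  rw [ContinuousLinearMap.bilinearComp_apply]
  have h := hQR g
  rwa [hT] at h

/-! ## §2. The per-scale reset: the next floor from the MODEL form's floor, no transport loss -/

/-- **THE NEXT FLOOR BY DOMINATION (the per-scale reset).**  `γ·R (D x) (D x) ≤ Q x x` for all `x` (`0 ≤ γ`), `R` `m`-coercive on
`ker D₂` ⟹ `(γ·m)‖g‖² ≤ (Q.bilinearComp T T) g g` on `ker D₂` — the transported Hessian's kernel coercivity from the coarse MODEL form's
Poincaré letter, with no `‖D‖`, no transport loss (compare TFC's `m₂∕d²`). [folklore] -/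
theorem kerCoercive_transported_of_domination (Q : E →L[ℝ] E →L[ℝ] ℝ) (R : F →L[ℝ] F →L[ℝ] ℝ) {D : E →L[ℝ] F} {T : F →L[ℝ] E}
    (hT : ∀ g, D (T g) = g) {γ : ℝ} (hγ : 0 ≤ γ) (hRQ : ∀ x, γ * R (D x) (D x) ≤ Q x x) (D₂ : F →L[ℝ] G) {m : ℝ}
    (hR : ∀ g, D₂ g = 0 → m * ‖g‖ ^ 2 ≤ R g g) : ∀ g, D₂ g = 0 → γ * m * ‖g‖ ^ 2 ≤ (Q.bilinearComp T T) g g := by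
  intro g hg
  calc γ * m * ‖g‖ ^ 2 = γ * (m * ‖g‖ ^ 2) := by ring
    _ ≤ γ * R g g := mul_le_mul_of_nonneg_left (hR g hg) hγ
    _ ≤ (Q.bilinearComp T T) g g := smul_le_transported_of_le_pullback Q R hT hRQ g

omit [NormedAddCommGroup G] [NormedSpace ℝ G] in
/-- The same on all of `F` (`R` coercive everywhere, e.g. a massive model form). [folklore] -/
theorem coercive_transported_of_domination (Q : E →L[ℝ] E →L[ℝ] ℝ) (R : F →L[ℝ] F →L[ℝ] ℝ) {D : E →L[ℝ] F} {T : F →L[ℝ] E}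
    (hT : ∀ g, D (T g) = g) {γ : ℝ} (hγ : 0 ≤ γ) (hRQ : ∀ x, γ * R (D x) (D x) ≤ Q x x) {m : ℝ}
    (hR : ∀ g, m * ‖g‖ ^ 2 ≤ R g g) (g : F) : γ * m * ‖g‖ ^ 2 ≤ (Q.bilinearComp T T) g g := by
  calc γ * m * ‖g‖ ^ 2 = γ * (m * ‖g‖ ^ 2) := by ring
    _ ≤ γ * R g g := mul_le_mul_of_nonneg_left (hR g) hγ
    _ ≤ (Q.bilinearComp T T) g g := smul_le_transported_of_le_pullback Q R hT hRQ g

/-- Both suppliers at hand: a displayed floor `m′` of the transported form on `ker D₂` (e.g. TFC's `m₂∕d²`) and the reset `γ·m` give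
the floor `max m′ (γ·m)`. [folklore] -/
theorem kerCoercive_transported_of_domination_max (Q : E →L[ℝ] E →L[ℝ] ℝ) (R : F →L[ℝ] F →L[ℝ] ℝ) {D : E →L[ℝ] F}
    {T : F →L[ℝ] E} (hT : ∀ g, D (T g) = g) {γ : ℝ} (hγ : 0 ≤ γ) (hRQ : ∀ x, γ * R (D x) (D x) ≤ Q x x) (D₂ : F →L[ℝ] G)
    {m m' : ℝ} (hR : ∀ g, D₂ g = 0 → m * ‖g‖ ^ 2 ≤ R g g) (hm' : ∀ g, D₂ g = 0 → m' * ‖g‖ ^ 2 ≤ (Q.bilinearComp T T) g g) :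
    ∀ g, D₂ g = 0 → max m' (γ * m) * ‖g‖ ^ 2 ≤ (Q.bilinearComp T T) g g := by
  intro g hg
  rcases le_total m' (γ * m) with h | h
  · rw [max_eq_right h]; exact kerCoercive_transported_of_domination Q R hT hγ hRQ D₂ hR g hg
  · rw [max_eq_left h]; exact hm' g hg

/-! ## §3. The tower in one shot (HSGT's shapes): level-`k` domination is one fine-level pullback inequality -/

section Tower

variable {X : ℕ → Type*} [∀ k, NormedAddCommGroup (X k)] [∀ k, NormedSpace ℝ (X k)]

/-- **LEVEL-`k` DOMINATION IN ONE SHOT.**  Composite blocking `Dc k : X 0 →L X k` and composite section `Tc k` with `Dc k (Tc k g) = g`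
(HSGT `tower_section`), a level-`k` MODEL form `R_k` on `X k`, and ONE fine-level inequality `γ·R_k (Dc k x)(Dc k x) ≤ Q x x` ⟹
`γ·R_k g g ≤ Q_k g g` for `Q_k = Q.bilinearComp (Tc k) (Tc k)` — no induction, no intermediate level. [folklore] -/
theorem tower_domination (Q : X 0 →L[ℝ] X 0 →L[ℝ] ℝ) {Dc : ∀ k, X 0 →L[ℝ] X k} {Tc : ∀ k, X k →L[ℝ] X 0}
    (hsec : ∀ k g, Dc k (Tc k g) = g) (k : ℕ) (R : X k →L[ℝ] X k →L[ℝ] ℝ) {γ : ℝ}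
    (hRQ : ∀ x, γ * R (Dc k x) (Dc k x) ≤ Q x x) (g : X k) : γ * R g g ≤ (Q.bilinearComp (Tc k) (Tc k)) g g :=
  smul_le_transported_of_le_pullback Q R (hsec k) hRQ g

/-- **LEVEL-`k` NEXT FLOOR BY DOMINATION**: + `R_k` `m`-coercive on `ker (D k)` (the level-`k` model's Poincaré letter), `0 ≤ γ` ⟹
`Q_k` is `(γ·m)`-coercive on `ker (D k)`. [folklore] -/
theorem tower_kerCoercive_of_domination (Q : X 0 →L[ℝ] X 0 →L[ℝ] ℝ) {D : ∀ k, X k →L[ℝ] X (k + 1)}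
    {Dc : ∀ k, X 0 →L[ℝ] X k} {Tc : ∀ k, X k →L[ℝ] X 0} (hsec : ∀ k g, Dc k (Tc k g) = g) (k : ℕ)
    (R : X k →L[ℝ] X k →L[ℝ] ℝ) {γ : ℝ} (hγ : 0 ≤ γ) (hRQ : ∀ x, γ * R (Dc k x) (Dc k x) ≤ Q x x) {m : ℝ}
    (hR : ∀ g, D k g = 0 → m * ‖g‖ ^ 2 ≤ R g g) :
    ∀ g, D k g = 0 → γ * m * ‖g‖ ^ 2 ≤ (Q.bilinearComp (Tc k) (Tc k)) g g :=
  kerCoercive_transported_of_domination Q R (hsec k) hγ hRQ (D k) hR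

end Tower

/-! ## §4. Toy -/

/-- Toy (`E = F = G = ℝ`, `Q = R = mul`, `D = T = 1`, `γ = 1`, `D₂ = 0`, `m = 1`): the reset returns `1·1·‖g‖² ≤ g·g` on `ker 0 = ℝ`. -/
example (g : ℝ) : (1 : ℝ) * 1 * ‖g‖ ^ 2 ≤
    ((ContinuousLinearMap.mul ℝ ℝ).bilinearComp (ContinuousLinearMap.id ℝ ℝ) (ContinuousLinearMap.id ℝ ℝ)) g g :=
  kerCoercive_transported_of_domination (ContinuousLinearMap.mul ℝ ℝ) (ContinuousLinearMap.mul ℝ ℝ)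
    (D := ContinuousLinearMap.id ℝ ℝ) (T := ContinuousLinearMap.id ℝ ℝ) (fun _ => rfl) zero_le_one
    (fun x => by rw [one_mul]; exact le_rfl) (0 : ℝ →L[ℝ] ℝ)
    (fun g _ => by rw [ContinuousLinearMap.mul_apply', one_mul, Real.norm_eq_abs, sq_abs, sq]) g (by simp)

end Summit.QuantumFields.BalabanUV.T4Continuum.NE7b.DominationTransfer
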